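import Summits.NavierStokesRegularity.NavierStokesRegularity.Theorems.CoriolisHeadNoCoRotatingCoreEnergyIdentity
import Literature.Analysis.FluidPDE.HarmonicProbe
import Literature.Analysis.FluidPDE.LerayHopfProofs
import HarnessLib

/-!
# CoriolisHeadLocalEnergyDriftProbe — crux `NoCoRotatingCore` (stmt-NavierStokesRegularity-22676), line `local_energy_rescue`
# (crux workfile, ns-idea-10 g3), stub S1 `stub_driftNormalForm` — file 1/3: probe tools

Tools for the reduction of S1 to the existence of a `BMO₂` Riesz pressure (file 3 `…DriftNormalForm`): averages against the
unit-mass radial bumps `χ_R` of `HarmonicProbe` (`abs_integral_probeBump_mul_le`), the reflection–translation of integrals,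
the DRIFT FLUX through a bump by integration by parts (`abs_integral_mul_fderiv_inner_drift_le`: `∫ ψ Df[V] = −∫ f Dψ[V] − 3a∫ψ f`,
`V = ay − By`, `div V = 3a` for skew `B`), and the `BMO₂` part of the probe of a gradient
(`exists_bound_integral_fderiv_probeBump_bmo`: `|∫ ∂ₑχ_R(z) N(x₀ − z) dz| ≤ C_N‖e‖` for `R ≥ 1`, by `∫∂ₑχ_R = 0`).

HONEST FRAMING.  Helper for an unregistered line; nothing here proves `NoCoRotatingCore` or NS regularity.

References: D. Gilbarg, N. Trudinger, *Elliptic PDE of second order*, Thm 2.1 [GilbargTrudinger2001]; G. Koch, N. Nadirashvili,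
G. Seregin, V. Šverák, Acta Math. 203 (2009), §4–§5 [KochNadirashviliSereginSverak2009].
-/

noncomputable section

open MeasureTheory Set Function Filter Topology Metric InnerProductSpace Real
open scoped RealInnerProductSpace Laplacian ContDiff Topology

-- the summit and its single sub-problem share the name (CONVENTIONS §1), as in every Theorems file
set_option linter.dupNamespace false

namespace Summit.NavierStokesRegularity.NavierStokesRegularity.Theorems.CoriolisHead

namespace LocalEnergyRescue

open Literature.Analysis.FluidPDE

/-! ## §1 Averages against the unit-mass bumps `χ_R` -/

/-- `|∫ χ_R g| ≤ C` if `|g| ≤ C` (`χ_R ≥ 0` has mass one). [folklore] -/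
theorem abs_integral_probeBump_mul_le {g : EuclideanSpace ℝ (Fin 3) → ℝ} {C : ℝ}
    (hC : ∀ y, |g y| ≤ C) {R : ℝ} (hR : 0 < R) (x₀ : EuclideanSpace ℝ (Fin 3)) :
    |∫ z, probeBump R z * g (x₀ - z)| ≤ C := by
  have hC0 : 0 ≤ C := (abs_nonneg _).trans (hC 0)
  have hχi : Integrable (probeBump (E := EuclideanSpace ℝ (Fin 3)) R) := integrable_probeBump hR
  have hdom : ∀ z, ‖probeBump R z * g (x₀ - z)‖ ≤ C * probeBump R z := fun z => by
    rw [norm_mul, Real.norm_of_nonneg (probeBump_nonneg hR z), Real.norm_eq_abs, mul_comm]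
    exact mul_le_mul_of_nonneg_right (hC _) (probeBump_nonneg hR z)
  have h := norm_integral_le_of_norm_le (hχi.const_mul C) (Eventually.of_forall hdom)
  rw [Real.norm_eq_abs, integral_const_mul, integral_probeBump hR, mul_one] at h
  exact h

/-- Reflection–translation: `∫ k(z) g(x₀ − z) dz = ∫ k(x₀ − w) g(w) dw`. [folklore] -/
theorem integral_mul_comp_sub_swap (k g : EuclideanSpace ℝ (Fin 3) → ℝ) (x₀ : EuclideanSpace ℝ (Fin 3)) :
    ∫ z, k z * g (x₀ - z) = ∫ w, k (x₀ - w) * g w := by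
  have h := integral_sub_left_eq_self (fun w => k (x₀ - w) * g w) (volume : Measure (EuclideanSpace ℝ (Fin 3))) x₀
  simp only [sub_sub_cancel] at h
  exact h

/-! ## §2 The drift term against a bump at scale `‖x₀‖` -/

section Drift

variable {a : ℝ} {B : EuclideanSpace ℝ (Fin 3) →L[ℝ] EuclideanSpace ℝ (Fin 3)}
  {U : EuclideanSpace ℝ (Fin 3) → EuclideanSpace ℝ (Fin 3)}

/-- **The drift flux through a bump at scale `R ≥ ‖x₀‖` is bounded.**  For `U ∈ C¹` bounded by `M`, div-free, `B` skew,
`f = ⟪e, U⟫`, `V(y) = ay − By` and `ψ ∈ C¹_c` supported in `B̄(x₀, 2R)` with `‖Dψ‖ ≤ D`, `|ψ| ≤ ...`: 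
`|∫ ψ(w) Df(w)[V w] dw| ≤ M‖e‖ (3|a| ∫|ψ| + D (|a| + ‖B‖)(‖x₀‖ + 2R) |B̄(x₀,2R)|)` — integration by parts of
`div(ψ f V) = ψ f div V + f Dψ[V] + ψ Df[V]`, `div V = 3a`. [folklore] -/
theorem abs_integral_mul_fderiv_inner_drift_le (hU : ContDiff ℝ 1 U) {M : ℝ} (hM : ∀ y, ‖U y‖ ≤ M)
    (hB : ∀ x, inner ℝ (B x) x = 0) (e : EuclideanSpace ℝ (Fin 3))
    {ψ : EuclideanSpace ℝ (Fin 3) → ℝ} (hψ : ContDiff ℝ 1 ψ) {x₀ : EuclideanSpace ℝ (Fin 3)} {R D : ℝ} (hR : 0 < R)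
    (hψs : ∀ w, w ∉ closedBall x₀ (2 * R) → ψ w = 0) (hψD : ∀ w, ‖fderiv ℝ ψ w‖ ≤ D)
    (hψD0 : ∀ w, w ∉ closedBall x₀ (2 * R) → fderiv ℝ ψ w = 0) (hψi : Integrable ψ) (hψ0 : ∀ w, 0 ≤ ψ w) :
    |∫ w, ψ w * fderiv ℝ (fun y => ⟪e, U y⟫) w (a • w - B w)| ≤
      M * ‖e‖ * (3 * |a| * ∫ w, ψ w) +
        M * ‖e‖ * (D * ((|a| + ‖B‖) * (‖x₀‖ + 2 * R))) * (volume (closedBall x₀ (2 * R))).toReal := by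
  have hM0 : 0 ≤ M := (norm_nonneg _).trans (hM 0)
  have hD0 : 0 ≤ D := (norm_nonneg _).trans (hψD x₀)
  set f : EuclideanSpace ℝ (Fin 3) → ℝ := fun y => ⟪e, U y⟫ with hf
  have hfc : ContDiff ℝ 1 f := contDiff_const.inner ℝ hU
  have hfM : ∀ y, |f y| ≤ ‖e‖ * M := fun y =>
    (abs_real_inner_le_norm e (U y)).trans (mul_le_mul_of_nonneg_left (hM y) (norm_nonneg _))
  set V : EuclideanSpace ℝ (Fin 3) → EuclideanSpace ℝ (Fin 3) := fun w => a • w - B w with hV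
  have hVc : ContDiff ℝ 1 V := (contDiff_id.const_smul a).sub B.contDiff
  have hVnorm : ∀ w, ‖V w‖ ≤ (|a| + ‖B‖) * ‖w‖ := fun w => by
    calc ‖V w‖ = ‖a • w - B w‖ := rfl
      _ ≤ ‖a • w‖ + ‖B w‖ := norm_sub_le _ _
      _ ≤ |a| * ‖w‖ + ‖B‖ * ‖w‖ := add_le_add (by rw [norm_smul, Real.norm_eq_abs]) (B.le_opNorm w)
      _ = (|a| + ‖B‖) * ‖w‖ := by ring
  -- `div V = 3a`
  have hdivV : ∀ w, VectorCalculus.divergence V w = 3 * a := fun w => by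
    have h := divergence_drift_eq (U := fun _ => (0 : EuclideanSpace ℝ (Fin 3))) (a := a) contDiff_const
      (fun x => by simp [VectorCalculus.divergence]) hB w
    have e1 : (fun y : EuclideanSpace ℝ (Fin 3) => (0 : EuclideanSpace ℝ (Fin 3)) - B y + a • y) = V := by
      funext y; simp only [hV, zero_sub]; abel
    rwa [e1] at h
  -- the compactly supported field `(ψ f) • V`
  have hprod : ContDiff ℝ 1 fun w => (ψ w * f w) • V w := (hψ.mul hfc).smul hVc
  have hK : IsCompact (closedBall x₀ (2 * R)) := isCompact_closedBall _ _
  have hsupp : HasCompactSupport fun w => (ψ w * f w) • V w :=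
    HasCompactSupport.intro hK fun w hw => by simp [hψs w hw]
  have hdiv0 := integral_divergence_eq_zero hprod hsupp
  -- expand the divergence pointwise
  have hpt : ∀ w, VectorCalculus.divergence (fun w => (ψ w * f w) • V w) w =
      ψ w * f w * (3 * a) + (f w * fderiv ℝ ψ w (V w) + ψ w * fderiv ℝ f w (V w)) := by
    intro w
    have hθ : DifferentiableAt ℝ (fun w => ψ w * f w) w :=
      ((hψ.differentiable one_ne_zero) w).mul ((hfc.differentiable one_ne_zero) w)
    rw [divergence_smul_apply hθ ((hVc.differentiable one_ne_zero) w), hdivV w, inner_gradient_right_eq_fderiv,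
      fderiv_fun_mul ((hψ.differentiable one_ne_zero) w) ((hfc.differentiable one_ne_zero) w)]
    simp only [FunLike.coe_add, FunLike.coe_smul, Pi.add_apply, Pi.smul_apply, smul_eq_mul]
    ring
  simp_rw [hpt] at hdiv0
  -- integrability of the three pieces (continuous, compactly supported)
  have cψ : Continuous ψ := hψ.continuous
  have cf : Continuous f := hfc.continuous
  have cV : Continuous V := hVc.continuous
  have cDψ : Continuous (fderiv ℝ ψ) := hψ.continuous_fderiv one_ne_zero
  have cDf : Continuous (fderiv ℝ f) := hfc.continuous_fderiv one_ne_zero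
  have s1 : HasCompactSupport fun w => ψ w * f w * (3 * a) :=
    HasCompactSupport.intro hK fun w hw => by simp [hψs w hw]
  have s2 : HasCompactSupport fun w => f w * fderiv ℝ ψ w (V w) :=
    HasCompactSupport.intro hK fun w hw => by simp [hψD0 w hw]
  have s3 : HasCompactSupport fun w => ψ w * fderiv ℝ f w (V w) :=
    HasCompactSupport.intro hK fun w hw => by simp [hψs w hw]
  have i1 : Integrable fun w => ψ w * f w * (3 * a) :=
    ((cψ.mul cf).mul continuous_const).integrable_of_hasCompactSupport s1
  have i2 : Integrable fun w => f w * fderiv ℝ ψ w (V w) :=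
    (cf.mul (cDψ.clm_apply cV)).integrable_of_hasCompactSupport s2
  have i3 : Integrable fun w => ψ w * fderiv ℝ f w (V w) :=
    (cψ.mul (cDf.clm_apply cV)).integrable_of_hasCompactSupport s3
  have i23 : Integrable fun w => f w * fderiv ℝ ψ w (V w) + ψ w * fderiv ℝ f w (V w) := i2.add i3
  rw [integral_add i1 i23, integral_add i2 i3] at hdiv0
  have hI3 : ∫ w, ψ w * fderiv ℝ f w (V w) = -(∫ w, ψ w * f w * (3 * a)) - ∫ w, f w * fderiv ℝ ψ w (V w) := by
    linarith
  -- bound the two integrals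
  have hb1 : |∫ w, ψ w * f w * (3 * a)| ≤ M * ‖e‖ * (3 * |a| * ∫ w, ψ w) := by
    have hdom : ∀ w, ‖ψ w * f w * (3 * a)‖ ≤ (M * ‖e‖ * (3 * |a|)) * ψ w := fun w => by
      rw [Real.norm_eq_abs, abs_mul, abs_mul, abs_of_nonneg (hψ0 w)]
      have := hfM w
      have h3 : |3 * a| = 3 * |a| := by rw [abs_mul, abs_of_pos (by norm_num : (0:ℝ) < 3)]
      rw [h3]
      have hnn : 0 ≤ ψ w * (3 * |a|) := mul_nonneg (hψ0 w) (by positivity)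
      calc ψ w * |f w| * (3 * |a|) = |f w| * (ψ w * (3 * |a|)) := by ring
        _ ≤ (‖e‖ * M) * (ψ w * (3 * |a|)) := mul_le_mul_of_nonneg_right this hnn
        _ = M * ‖e‖ * (3 * |a|) * ψ w := by ring
    have h := norm_integral_le_of_norm_le (hψi.const_mul _) (Eventually.of_forall hdom)
    rw [Real.norm_eq_abs, integral_const_mul] at h
    exact h.trans (le_of_eq (by ring))
  have hb2 : |∫ w, f w * fderiv ℝ ψ w (V w)| ≤
      M * ‖e‖ * (D * ((|a| + ‖B‖) * (‖x₀‖ + 2 * R))) * (volume (closedBall x₀ (2 * R))).toReal := by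
    set c : ℝ := M * ‖e‖ * (D * ((|a| + ‖B‖) * (‖x₀‖ + 2 * R))) with hc
    have hc0 : 0 ≤ c := by positivity
    set g : EuclideanSpace ℝ (Fin 3) → ℝ := fun w => (closedBall x₀ (2 * R)).indicator (fun _ => c) w with hgdef
    have hdom : ∀ w, ‖f w * fderiv ℝ ψ w (V w)‖ ≤ g w := by
      intro w
      by_cases hw : w ∈ closedBall x₀ (2 * R)
      · simp only [hgdef, indicator_of_mem hw]
        rw [norm_mul, Real.norm_eq_abs]
        have hwn : ‖w‖ ≤ ‖x₀‖ + 2 * R := by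
          rw [mem_closedBall, dist_eq_norm] at hw
          calc ‖w‖ = ‖(w - x₀) + x₀‖ := by rw [sub_add_cancel]
            _ ≤ ‖w - x₀‖ + ‖x₀‖ := norm_add_le _ _
            _ ≤ ‖x₀‖ + 2 * R := by linarith
        have h1 : ‖fderiv ℝ ψ w (V w)‖ ≤ D * ((|a| + ‖B‖) * (‖x₀‖ + 2 * R)) :=
          calc ‖fderiv ℝ ψ w (V w)‖ ≤ ‖fderiv ℝ ψ w‖ * ‖V w‖ := ContinuousLinearMap.le_opNorm _ _
            _ ≤ D * ((|a| + ‖B‖) * ‖w‖) := mul_le_mul (hψD w) (hVnorm w) (norm_nonneg _) hD0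
            _ ≤ D * ((|a| + ‖B‖) * (‖x₀‖ + 2 * R)) := by gcongr
        calc |f w| * ‖fderiv ℝ ψ w (V w)‖ ≤ (‖e‖ * M) * (D * ((|a| + ‖B‖) * (‖x₀‖ + 2 * R))) :=
              mul_le_mul (hfM w) h1 (norm_nonneg _) (by positivity)
          _ = c := by rw [hc]; ring
      · simp only [hgdef, indicator_of_notMem hw, hψD0 w hw]
        simp
    have hgi : Integrable g := by
      rw [hgdef, integrable_indicator_iff measurableSet_closedBall]
      exact integrableOn_const hK.measure_lt_top.ne
    have h := norm_integral_le_of_norm_le hgi (Eventually.of_forall hdom)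
    rw [Real.norm_eq_abs] at h
    refine h.trans (le_of_eq ?_)
    rw [hgdef, integral_indicator measurableSet_closedBall, setIntegral_const, smul_eq_mul, measureReal_def, mul_comm]
  rw [hI3]
  have := abs_sub (-(∫ w, ψ w * f w * (3 * a))) (∫ w, f w * fderiv ℝ ψ w (V w))
  rw [abs_neg] at this
  linarith

end Drift

/-! ## §3 The `BMO₂` part against the gradient of a bump -/

/-- Reflection–translation of a closed-ball integral: `∫_{B̄(0,ρ)} h(x₀ − z) dz = ∫_{B̄(x₀,ρ)} h`. [folklore] -/
theorem setIntegral_closedBall_comp_sub (h : EuclideanSpace ℝ (Fin 3) → ℝ) (x₀ : EuclideanSpace ℝ (Fin 3)) (ρ : ℝ) :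
    ∫ z in closedBall (0 : EuclideanSpace ℝ (Fin 3)) ρ, h (x₀ - z) = ∫ w in closedBall x₀ ρ, h w := by
  rw [← integral_indicator measurableSet_closedBall, ← integral_indicator measurableSet_closedBall]
  have key : ∀ z, (closedBall (0 : EuclideanSpace ℝ (Fin 3)) ρ).indicator (fun z => h (x₀ - z)) z =
      (closedBall x₀ ρ).indicator h (x₀ - z) := by
    intro z
    have hmem : z ∈ closedBall (0 : EuclideanSpace ℝ (Fin 3)) ρ ↔ x₀ - z ∈ closedBall x₀ ρ := by
      rw [mem_closedBall, mem_closedBall, dist_zero_right, dist_eq_norm, sub_sub_cancel_left, norm_neg]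
    by_cases hz : z ∈ closedBall (0 : EuclideanSpace ℝ (Fin 3)) ρ
    · rw [indicator_of_mem hz, indicator_of_mem (hmem.1 hz)]
    · rw [indicator_of_notMem hz, indicator_of_notMem (fun h' => hz (hmem.2 h'))]
  simp_rw [key]
  exact integral_sub_left_eq_self ((closedBall x₀ ρ).indicator h) volume x₀

/-- **The `BMO₂` part.**  If `N` is continuous with `∫_{B(z,ρ)}(N − m)² ≤ Kρ³` (all balls), then for `R ≥ 1` and all `x₀, e`:
`|∫ ∂ₑχ_R(z) N(x₀ − z) dz| ≤ C_N ‖e‖` with `C_N` depending on `K` and the bump only (`∫ ∂ₑχ_R = 0`, `‖Dχ_R‖ ≲ R⁻⁴`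
on `B̄(0, 2R)`, and `|N − m| ≤ ((N − m)² + 1)/2`). [folklore] -/
theorem exists_bound_integral_fderiv_probeBump_bmo {N : EuclideanSpace ℝ (Fin 3) → ℝ} (hN : Continuous N) {K : ℝ}
    (hK : ∀ (z : EuclideanSpace ℝ (Fin 3)) (ρ : ℝ), 0 < ρ → ∃ m : ℝ, ∫ y in ball z ρ, (N y - m) ^ 2 ≤ K * ρ ^ 3) :
    ∃ C : ℝ, 0 ≤ C ∧ ∀ (x₀ e : EuclideanSpace ℝ (Fin 3)) (R : ℝ), 1 ≤ R →
      |∫ z, fderiv ℝ (probeBump R) z e * N (x₀ - z)| ≤ C * ‖e‖ := by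
  obtain ⟨Cθ, hCθ⟩ := (exists_bound_baseBump_derivs (E := EuclideanSpace ℝ (Fin 3))).1
  set m₀ := baseBumpMass (EuclideanSpace ℝ (Fin 3)) with hm₀
  have hm₀pos : 0 < m₀ := baseBumpMass_pos
  set W₁ : ℝ := (volume (closedBall (0 : EuclideanSpace ℝ (Fin 3)) 1)).toReal with hW₁
  have hC0 : 0 ≤ Cθ := (norm_nonneg _).trans (hCθ 0)
  have hK0 : 0 ≤ K := by
    obtain ⟨m, hm⟩ := hK 0 1 one_pos
    have h0 : 0 ≤ ∫ y in ball (0 : EuclideanSpace ℝ (Fin 3)) 1, (N y - m) ^ 2 :=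
      setIntegral_nonneg measurableSet_ball fun y _ => sq_nonneg _
    linarith
  refine ⟨m₀⁻¹ * Cθ * ((27 * K + 8 * W₁) / 2), by positivity, fun x₀ e R hR => ?_⟩
  have hRpos : 0 < R := by linarith
  -- the gauge on `B(x₀, 3R)`
  obtain ⟨m, hm⟩ := hK x₀ (3 * R) (by positivity)
  -- `∫ ∂ₑχ_R · m = 0`
  have hχ1 : ContDiff ℝ 1 (probeBump (E := EuclideanSpace ℝ (Fin 3)) R) := contDiff_probeBump R
  have hχc := hasCompactSupport_probeBump (E := EuclideanSpace ℝ (Fin 3)) hRpos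
  have hzero : ∫ z, fderiv ℝ (probeBump R) z e * m = 0 := by
    rw [integral_mul_const, integral_fderiv_apply_eq_zero hχ1 hχc e, zero_mul]
  have hDc : Continuous fun z => fderiv ℝ (probeBump (E := EuclideanSpace ℝ (Fin 3)) R) z e :=
    (hχ1.continuous_fderiv one_ne_zero).clm_apply continuous_const
  have hDs : HasCompactSupport fun z => fderiv ℝ (probeBump (E := EuclideanSpace ℝ (Fin 3)) R) z e :=
    hχc.fderiv_apply (𝕜 := ℝ) e
  have hNc0 : Continuous fun z : EuclideanSpace ℝ (Fin 3) => N (x₀ - z) :=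
    hN.comp ((continuous_const (y := x₀)).sub continuous_id)
  have i1 : Integrable fun z => fderiv ℝ (probeBump R) z e * N (x₀ - z) :=
    (hDc.mul hNc0).integrable_of_hasCompactSupport hDs.mul_right
  have i2 : Integrable fun z => fderiv ℝ (probeBump R) z e * m :=
    (hDc.mul continuous_const).integrable_of_hasCompactSupport hDs.mul_right
  have hsplit : ∫ z, fderiv ℝ (probeBump R) z e * N (x₀ - z) =
      ∫ z, fderiv ℝ (probeBump R) z e * (N (x₀ - z) - m) := by
    have e1 : ∀ z, fderiv ℝ (probeBump R) z e * (N (x₀ - z) - m) =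
        fderiv ℝ (probeBump R) z e * N (x₀ - z) - fderiv ℝ (probeBump R) z e * m := fun z => by ring
    simp_rw [e1]
    rw [integral_sub i1 i2, hzero, sub_zero]
  rw [hsplit]
  -- the bound on `Dχ_R`
  set c : ℝ := (m₀ * R ^ Module.finrank ℝ (EuclideanSpace ℝ (Fin 3)))⁻¹ * R⁻¹ * Cθ with hc
  have hc0 : 0 ≤ c := by positivity
  have hDχ : ∀ z, ‖fderiv ℝ (probeBump (E := EuclideanSpace ℝ (Fin 3)) R) z‖ ≤ c := fun z =>
    norm_fderiv_probeBump_le hRpos hCθ z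
  -- domination by an integrable majorant on `B̄(0, 2R)`
  set g : EuclideanSpace ℝ (Fin 3) → ℝ := fun z =>
    (closedBall (0 : EuclideanSpace ℝ (Fin 3)) (2 * R)).indicator
      (fun z => c * ‖e‖ * (((N (x₀ - z) - m) ^ 2 + 1) / 2)) z with hg
  have hdom : ∀ z, ‖fderiv ℝ (probeBump R) z e * (N (x₀ - z) - m)‖ ≤ g z := by
    intro z
    by_cases hz : z ∈ closedBall (0 : EuclideanSpace ℝ (Fin 3)) (2 * R)
    · simp only [hg, indicator_of_mem hz]
      rw [norm_mul, Real.norm_eq_abs, Real.norm_eq_abs]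
      have h1 : |fderiv ℝ (probeBump R) z e| ≤ c * ‖e‖ := by
        rw [← Real.norm_eq_abs]
        exact (ContinuousLinearMap.le_opNorm _ _).trans (mul_le_mul_of_nonneg_right (hDχ z) (norm_nonneg _))
      have h2 : |N (x₀ - z) - m| ≤ ((N (x₀ - z) - m) ^ 2 + 1) / 2 := by
        nlinarith [sq_nonneg (|N (x₀ - z) - m| - 1), sq_abs (N (x₀ - z) - m), abs_nonneg (N (x₀ - z) - m)]
      exact mul_le_mul h1 h2 (abs_nonneg _) (by positivity)
    · simp only [hg, indicator_of_notMem hz]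
      have hz' : z ∉ tsupport (probeBump (E := EuclideanSpace ℝ (Fin 3)) R) := fun h =>
        hz (tsupport_probeBump_subset hRpos h)
      rw [fderiv_of_notMem_tsupport ℝ hz']
      simp
  have hNc : Continuous fun z : EuclideanSpace ℝ (Fin 3) => N (x₀ - z) :=
    hN.comp ((continuous_const (y := x₀)).sub continuous_id)
  have hgc : Continuous fun z => c * ‖e‖ * (((N (x₀ - z) - m) ^ 2 + 1) / 2) :=
    continuous_const.mul (((hNc.sub continuous_const).pow 2).add continuous_const |>.div_const 2)
  have hgi : Integrable g := by
    rw [hg, integrable_indicator_iff measurableSet_closedBall]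
    exact (hgc.continuousOn.integrableOn_compact (isCompact_closedBall _ _))
  have hint := norm_integral_le_of_norm_le hgi (Eventually.of_forall hdom)
  rw [Real.norm_eq_abs] at hint
  refine hint.trans ?_
  -- evaluate `∫ g`
  rw [hg, integral_indicator measurableSet_closedBall]
  have i3 : IntegrableOn (fun z => (N (x₀ - z) - m) ^ 2) (closedBall (0 : EuclideanSpace ℝ (Fin 3)) (2 * R)) volume :=
    ((hNc.sub continuous_const).pow 2).continuousOn.integrableOn_compact (isCompact_closedBall _ _)
  have i4 : IntegrableOn (fun _ => (1 : ℝ)) (closedBall (0 : EuclideanSpace ℝ (Fin 3)) (2 * R)) volume :=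
    integrableOn_const (isCompact_closedBall _ _).measure_lt_top.ne
  have e2 : ∫ z in closedBall (0 : EuclideanSpace ℝ (Fin 3)) (2 * R), c * ‖e‖ * (((N (x₀ - z) - m) ^ 2 + 1) / 2) =
      c * ‖e‖ / 2 * ((∫ z in closedBall (0 : EuclideanSpace ℝ (Fin 3)) (2 * R), (N (x₀ - z) - m) ^ 2) +
        ∫ z in closedBall (0 : EuclideanSpace ℝ (Fin 3)) (2 * R), (1 : ℝ)) := by
    rw [← integral_add i3 i4, ← integral_const_mul]
    refine integral_congr_ae (Eventually.of_forall fun z => ?_)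
    ring
  rw [e2, setIntegral_closedBall_comp_sub (fun w => (N w - m) ^ 2) x₀ (2 * R), setIntegral_const, smul_eq_mul, mul_one,
    measureReal_def, Measure.addHaar_closedBall' volume (0 : EuclideanSpace ℝ (Fin 3)) (by positivity : (0:ℝ) ≤ 2 * R),
    ENNReal.toReal_mul, ENNReal.toReal_ofReal (by positivity), finrank_euclideanSpace_fin]
  -- `∫_{B̄(x₀,2R)} (N−m)² ≤ ∫_{B(x₀,3R)} (N−m)² ≤ 27 K R³`
  have hsub : closedBall x₀ (2 * R) ⊆ ball x₀ (3 * R) := closedBall_subset_ball (by linarith)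
  have hmono : ∫ w in closedBall x₀ (2 * R), (N w - m) ^ 2 ≤ ∫ w in ball x₀ (3 * R), (N w - m) ^ 2 :=
    setIntegral_mono_set (((hN.sub continuous_const).pow 2).continuousOn.integrableOn_compact
      (isCompact_closedBall x₀ (3 * R)) |>.mono_set ball_subset_closedBall)
      (Eventually.of_forall fun w => sq_nonneg _) hsub.eventuallyLE
  have hball : ∫ w in closedBall x₀ (2 * R), (N w - m) ^ 2 ≤ 27 * K * R ^ 3 := by
    refine hmono.trans (hm.trans (le_of_eq (by ring)))
  have hc' : c = m₀⁻¹ * Cθ * (R ^ 3)⁻¹ * R⁻¹ := by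
    rw [hc, finrank_euclideanSpace_fin]; ring
  rw [hc']
  have hR3 : 0 < R ^ 3 := by positivity
  have hW0 : 0 ≤ W₁ := ENNReal.toReal_nonneg
  -- final arithmetic
  have hgoal : m₀⁻¹ * Cθ * (R ^ 3)⁻¹ * R⁻¹ * ‖e‖ / 2 *
      ((∫ w in closedBall x₀ (2 * R), (N w - m) ^ 2) + (2 * R) ^ 3 * W₁) ≤
      m₀⁻¹ * Cθ * ((27 * K + 8 * W₁) / 2) * ‖e‖ := by
    have h1 : (∫ w in closedBall x₀ (2 * R), (N w - m) ^ 2) + (2 * R) ^ 3 * W₁ ≤ (27 * K + 8 * W₁) * R ^ 3 := by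
      nlinarith [hball]
    have hpre : 0 ≤ m₀⁻¹ * Cθ * (R ^ 3)⁻¹ * R⁻¹ * ‖e‖ / 2 := by positivity
    calc m₀⁻¹ * Cθ * (R ^ 3)⁻¹ * R⁻¹ * ‖e‖ / 2 *
          ((∫ w in closedBall x₀ (2 * R), (N w - m) ^ 2) + (2 * R) ^ 3 * W₁)
        ≤ m₀⁻¹ * Cθ * (R ^ 3)⁻¹ * R⁻¹ * ‖e‖ / 2 * ((27 * K + 8 * W₁) * R ^ 3) :=
          mul_le_mul_of_nonneg_left h1 hpre
      _ = m₀⁻¹ * Cθ * ((27 * K + 8 * W₁) / 2) * ‖e‖ * R⁻¹ := by field_simp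
      _ ≤ m₀⁻¹ * Cθ * ((27 * K + 8 * W₁) / 2) * ‖e‖ * 1 := by
          refine mul_le_mul_of_nonneg_left (inv_le_one_of_one_le₀ hR) (by positivity)
      _ = m₀⁻¹ * Cθ * ((27 * K + 8 * W₁) / 2) * ‖e‖ := mul_one _
  rw [← hW₁]
  exact hgoal


end LocalEnergyRescue

end Summit.NavierStokesRegularity.NavierStokesRegularity.Theorems.CoriolisHead

end
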